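import Literature.MathematicalPhysics.QuantumLattice.FermionBoxTilingProductState
import HarnessLib

/-!
# Entropy and energy densities of the box-tiling trial state: `s̄(ω̄_n) ≥ S(ρ₀)/n^d` and
# `|e_Ψ(ω̄_n) − (Re tr(H_{[0,n)^d} ρ₀) − Re(Ψ∅))/n^d| ≤ col_R(n)·S_Ψ/n^d`

Topic `Literature/MathematicalPhysics/QuantumLattice` (family `hubbard`, model-free, general `d ≥ 1`). Sequel of
`FermionBoxTilingProductState.lean` (the `nℤ^d`-periodic product `ω_n = ⊗_v ρ₀` of one faithful even box state and its
translation-invariant cell average `ω̄_n = boxTrialState`). This file computes the two densities of `ω̄_n` that enter the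
Gibbs variational functional `s̄ − β e_Ψ` (Bratteli–Robinson II, proof of Thm. 6.2.40):

* §1 density matrices of translation averages are averages (`rdm_shiftAverage`), hence by CONCAVITY of the von Neumann
  entropy `|C|⁻¹ Σ_c S((ω ∘ τ_{pos c})|_Λ) ≤ S(ω̄|_Λ)` (`le_vonNeumannEntropy_rdm_shiftAverage`).
* §2 ENTROPY: a translate `[0,kn)^d + v` (`v ∈ [0,n)^d`) contains the `(k−1)^d` full boxes `B_u`, `u ∈ 1⃗ + [0,k−1)^d`, so
  `S(ω_n|_{[0,kn)^d + v}) ≥ (k−1)^d S(ρ₀)` (full-block lower bound of `FermionBlockProductStateEntropy`), hence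
  `S(ω̄_n|_{[0,kn)^d}) ≥ (k−1)^d S(ρ₀)` and, the mean entropy of the translation-invariant `ω̄_n` being a limit
  (`TIStateMeanEntropy`), **`S(ρ₀)/n^d ≤ s̄(ω̄_n)`** (`le_entropyDensitySup_boxTrialState`).
* §3 ENERGY: for a translation-covariant interaction `Ψ` of finite range `R`, the tiling state has
  `ω_n(H_{[0,kn)^d}) = k^d tr(H_{[0,n)^d} ρ₀) − (k^d − 1)(Ψ∅)_{∅∅} + ω_n(W)` with `|ω_n(W)| ≤ k^d col(n) S_Ψ`
  (`FermionBoxTilingPartitionFunction`), the translates `[0,kn)^d + v` differ from the aligned box `n·1⃗ + [0,(k−2)n)^d` by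
  `(kn)^d − ((k−2)n)^d` sites (`FermionNestedRegionPartitionFunction.norm_far_add_cross_le`), and `ω̄_n` is translation
  invariant (`abs_card_mul_meanEnergy_sub_le`); letting `k → ∞`:
  **`|e_Ψ(ω̄_n) − (Re tr(H_{[0,n)^d} ρ₀) − Re (Ψ∅)_{∅∅})/n^d| ≤ col_R(n) S_Ψ/n^d`** (`abs_meanEnergy_boxTrialState_sub_le`),
  `col_R(n) = |thicken_R([0,n)^d) ∖ [0,n)^d|`.

Everything is PROVED; no definition, no named fact, no number.

## Tree / Mathlib search

REUSED: `boxTilingState`, `boxTrialState`, `boxTrialState_expect/_isTranslationInvariant`, `boxTilingState_shift_smul`,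
`boxTilingState_expect_localHamiltonian`, `boxPartition`, `cellPos_mem_halfOpenBox`, `card_cell_const_sub_one` (`FermionBoxTilingProductState`);
`card_mul_le_vonNeumannEntropy_rdm_blockProductState`, `vonNeumannEntropy_boxCopy` (`…Entropy` files); `vonNeumannEntropy_convexComb_ge`
(`VonNeumannEntropyConcavity`); `vonNeumannEntropy_rdm_shift` (`InfVolFermionStateRegionEntropy`); `IsTranslationInvariant.tendsto_boxEntropyDensity`,
`mem_shiftSet_smul_halfOpenBox` (`TIStateMeanEntropy`); `localHamiltonian_box_eq_decoupled_add_straddling_sub`, `norm_straddling_le`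
(`FermionBoxTilingPartitionFunction`); `localHamiltonian_eq_fermionEmbed_add_far_add_cross`, `norm_far_add_cross_le`; `abs_re_expect_le`;
`IsTranslationInvariant.abs_card_mul_meanEnergy_sub_le`, `expect_empty_eq`; `tendsto_collar_div_pow` (`FermionFreeBoundaryPressureExists`).

## References

* O. Bratteli, D. W. Robinson, *OAQSM 2* (1997), Prop. 6.2.38 / Thm. 6.2.40 (entropy and energy per volume of the averaged
  periodic product state). [cite: BratteliRobinsonII1997, Thm. 6.2.40]
* H. Araki, H. Moriya, Rev. Math. Phys. 15 (2003) 93, §10–§11 (mean entropy, variational principle). [cite: ArakiMoriya2003, Theorem 3.8 and §10]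
* M. A. Nielsen, I. L. Chuang, *QCQI* (2010), Thm. 11.10 (concavity of the entropy). [cite: NielsenChuang2010, Theorem 11.10 eq. (11.87) p.517]
-/

noncomputable section

namespace Literature.MathematicalPhysics.QuantumLattice

open Matrix Finset HubbardWave0 Literature.Probability.LatticeModels ThermodynamicLimit
open scoped ComplexOrder BigOperators Matrix.Norms.L2Operator
open Literature.InformationTheory.Entropy (vonNeumannEntropy vonNeumannEntropy_convexComb_ge vonNeumannEntropy_nonneg)
open Literature.Computability.QuantumComplexity (IsDensity)
open _root_.Filter
open scoped _root_.Topology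

namespace InfVolFermionState

variable {d : ℕ}

/-! ### §1. Density matrices of translation averages; concavity -/

section Average

variable {κ : Type} [Fintype κ] [Nonempty κ]

/-- **The density matrices of a translation average are the averages of the translates' density matrices.**
[cite: BratteliRobinsonI1987, §4.3.1] -/
theorem rdm_shiftAverage (pos : κ → Site d) (ω : InfVolFermionState d) (Λ : Finset (Site d)) :
    (ω.shiftAverage pos).rdm Λ = ∑ k, ((((Fintype.card κ : ℝ)⁻¹ : ℝ)) : ℂ) • (ω.shift (pos k)).rdm Λ := by
  ext s t
  simp only [rdm_apply, shiftAverage_expect, Matrix.sum_apply, Matrix.smul_apply, smul_eq_mul, Finset.mul_sum]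

/-- **Concavity**: `|κ|⁻¹ Σ_k S((ω ∘ τ_{pos k})|_Λ) ≤ S((avg ω)|_Λ)`. [cite: NielsenChuang2010, Theorem 11.10 eq. (11.87) p.517] -/
theorem le_vonNeumannEntropy_rdm_shiftAverage [DecidableEq κ] (pos : κ → Site d) (ω : InfVolFermionState d) (Λ : Finset (Site d)) :
    (Fintype.card κ : ℝ)⁻¹ * ∑ k, vonNeumannEntropy ((ω.shift (pos k)).rdm Λ) ≤ vonNeumannEntropy ((ω.shiftAverage pos).rdm Λ) := by
  have hκ : (Fintype.card κ : ℝ) ≠ 0 := Nat.cast_ne_zero.2 Fintype.card_ne_zero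
  have hp1 : ∑ _k : κ, (Fintype.card κ : ℝ)⁻¹ = 1 := by
    rw [Finset.sum_const, Finset.card_univ, nsmul_eq_mul, mul_inv_cancel₀ hκ]
  have hd : ∀ k, IsDensity ((ω.shift (pos k)).rdm Λ) := fun k => ⟨(ω.shift (pos k)).rdm_posSemidef Λ, (ω.shift (pos k)).trace_rdm Λ⟩
  have h := vonNeumannEntropy_convexComb_ge (fun _ : κ => (Fintype.card κ : ℝ)⁻¹) (fun _ => inv_nonneg.2 (Nat.cast_nonneg _))
    hp1 (fun k => (ω.shift (pos k)).rdm Λ) hd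
  rw [← Finset.mul_sum] at h
  rw [rdm_shiftAverage]
  exact h

end Average

/-! ### §2. The entropy density of the trial state -/

section Entropy

variable (n : ℕ) (hn : 1 ≤ n) (ρ₀ : FermionOp (halfOpenBox d n)) (hev : parityAut ρ₀ = ρ₀) (hpd : ρ₀.PosDef) (htr : ρ₀.trace = 1)

/-- **A translate `[0,kn)^d + v` of the big box (`v ∈ [0,n)^d`, `k ≥ 1`) contains the full boxes `B_u`, `u ∈ 1⃗ + [0,k−1)^d`.**
[cite: BratteliRobinsonII1997, Thm. 6.2.40] -/
theorem block_add_one_subset_shiftSet {k : ℕ} (hk : 1 ≤ k) {v : Site d} (hv : v ∈ halfOpenBox d n) {j : Site d}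
    (hj : j ∈ halfOpenBox d (k - 1)) :
    (boxPartition d n hn).block (j + fun _ => 1) ⊆ shiftSet v (halfOpenBox d (k * n)) := by
  intro x hx
  rw [boxPartition_block, mem_shiftSet_smul_halfOpenBox] at hx
  rw [mem_shiftSet, mem_halfOpenBox]
  rw [mem_halfOpenBox] at hv hj
  intro i
  obtain ⟨h1, h2⟩ := hx i
  obtain ⟨hv1, hv2⟩ := hv i
  obtain ⟨hj1, hj2⟩ := hj i
  simp only [Pi.add_apply] at h1 h2
  have hk' : (((k - 1 : ℕ)) : ℤ) = (k : ℤ) - 1 := by omega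
  rw [hk'] at hj2
  have hn0 : (0 : ℤ) ≤ n := Int.natCast_nonneg n
  simp only [Pi.sub_apply]
  push_cast
  constructor
  · nlinarith
  · nlinarith

/-- … and each of them is a class met by the translate. [cite: BratteliRobinsonII1997, Thm. 6.2.40] -/
theorem add_one_mem_blockClasses_shiftSet {k : ℕ} (hk : 1 ≤ k) {v : Site d} (hv : v ∈ halfOpenBox d n) {j : Site d}
    (hj : j ∈ halfOpenBox d (k - 1)) :
    (j + fun _ => 1) ∈ (boxPartition d n hn).blockClasses (shiftSet v (halfOpenBox d (k * n))) := by
  have hx : (n : ℤ) • (j + fun _ => (1 : ℤ)) ∈ (boxPartition d n hn).block (j + fun _ => 1) := by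
    rw [boxPartition_block, mem_shiftSet_smul_halfOpenBox]
    intro i
    have hn0 : (0 : ℤ) < n := by exact_mod_cast hn
    simp only [Pi.smul_apply, smul_eq_mul]
    constructor <;> linarith
  exact (boxPartition d n hn).mem_blockClasses_of_mem (block_add_one_subset_shiftSet n hn hk hv hj hx)
    (((boxPartition d n hn).mem_block_iff _ _).1 hx)

/-- **At least `(k−1)^d` full boxes** lie in `[0,kn)^d + v`. [cite: BratteliRobinsonII1997, Thm. 6.2.40] -/
theorem pow_le_card_filter_block_subset {k : ℕ} (hk : 1 ≤ k) {v : Site d} (hv : v ∈ halfOpenBox d n) :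
    (k - 1) ^ d ≤ (((boxPartition d n hn).blockClasses (shiftSet v (halfOpenBox d (k * n)))).filter
      fun u => (boxPartition d n hn).block u ⊆ shiftSet v (halfOpenBox d (k * n))).card := by
  classical
  have hsub : (halfOpenBox d (k - 1)).image (fun j : Site d => j + fun _ => (1 : ℤ)) ⊆
      ((boxPartition d n hn).blockClasses (shiftSet v (halfOpenBox d (k * n)))).filter
        fun u => (boxPartition d n hn).block u ⊆ shiftSet v (halfOpenBox d (k * n)) := by
    intro u hu
    obtain ⟨j, hj, rfl⟩ := Finset.mem_image.1 hu
    exact Finset.mem_filter.2 ⟨add_one_mem_blockClasses_shiftSet n hn hk hv hj, block_add_one_subset_shiftSet n hn hk hv hj⟩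
  refine le_trans ?_ (Finset.card_le_card hsub)
  rw [Finset.card_image_of_injective _ (add_left_injective _), card_halfOpenBox]

/-- **Box entropies of the tiling state on translates of the big box**: `(k−1)^d · S(ρ₀) ≤ S(ω_n|_{[0,kn)^d + v})`.
[cite: BratteliRobinsonII1997, Thm. 6.2.40] -/
theorem pow_mul_le_vonNeumannEntropy_rdm_boxTilingState_shiftSet {k : ℕ} (hk : 1 ≤ k) {v : Site d} (hv : v ∈ halfOpenBox d n) :
    ((k : ℝ) - 1) ^ d * vonNeumannEntropy ρ₀ ≤
      vonNeumannEntropy ((boxTilingState n hn ρ₀ hev hpd.posSemidef htr).rdm (shiftSet v (halfOpenBox d (k * n)))) := by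
  classical
  have h := card_mul_le_vonNeumannEntropy_rdm_blockProductState (boxPartition d n hn) (fun v => boxCopy n ρ₀ v)
    (fun v => parityAut_boxCopy n v hev) (fun v => posDef_boxCopy n v hpd) (fun v => (trace_boxCopy n ρ₀ v).trans htr)
    (shiftSet v (halfOpenBox d (k * n))) (s := vonNeumannEntropy ρ₀) (fun v => (vonNeumannEntropy_boxCopy n v hpd.1).ge)
  refine le_trans ?_ (le_trans h (le_of_eq ?_))
  · refine mul_le_mul_of_nonneg_right ?_ (vonNeumannEntropy_nonneg hpd.posSemidef htr)
    have hc := pow_le_card_filter_block_subset n hn hk hv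
    have hk' : ((k : ℝ) - 1) = ((k - 1 : ℕ) : ℝ) := by rw [Nat.cast_sub hk, Nat.cast_one]
    rw [hk']
    exact_mod_cast hc
  · rfl

/-- **Box entropies of the trial state**: `(k−1)^d · S(ρ₀) ≤ S(ω̄_n|_{[0,kn)^d})` (concavity over the cell average).
[cite: BratteliRobinsonII1997, Thm. 6.2.40] -/
theorem pow_mul_le_vonNeumannEntropy_rdm_boxTrialState {k : ℕ} (hk : 1 ≤ k) :
    ((k : ℝ) - 1) ^ d * vonNeumannEntropy ρ₀ ≤
      vonNeumannEntropy ((boxTrialState n hn ρ₀ hev hpd.posSemidef htr).rdm (halfOpenBox d (k * n))) := by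
  rw [boxTrialState_def, InfVolFermionState.cellAverage]
  refine le_trans ?_ (le_vonNeumannEntropy_rdm_shiftAverage _ _ _)
  have hcard : (Fintype.card (Cell (fun _ : Fin d => n - 1)) : ℝ) ≠ 0 := Nat.cast_ne_zero.2 Fintype.card_ne_zero
  -- every translate has the same lower bound
  have hterm : ∀ c : Cell (fun _ : Fin d => n - 1), ((k : ℝ) - 1) ^ d * vonNeumannEntropy ρ₀ ≤
      vonNeumannEntropy (((boxTilingState n hn ρ₀ hev hpd.posSemidef htr).shift (cellPos c)).rdm (halfOpenBox d (k * n))) := by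
    intro c
    rw [vonNeumannEntropy_rdm_shift]
    exact pow_mul_le_vonNeumannEntropy_rdm_boxTilingState_shiftSet n hn ρ₀ hev hpd htr hk (cellPos_mem_halfOpenBox n hn c)
  calc ((k : ℝ) - 1) ^ d * vonNeumannEntropy ρ₀
      = (Fintype.card (Cell (fun _ : Fin d => n - 1)) : ℝ)⁻¹ *
          ∑ _c : Cell (fun _ : Fin d => n - 1), ((k : ℝ) - 1) ^ d * vonNeumannEntropy ρ₀ := by
        rw [Finset.sum_const, Finset.card_univ, nsmul_eq_mul, ← mul_assoc, inv_mul_cancel₀ hcard, one_mul]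
    _ ≤ _ := mul_le_mul_of_nonneg_left (Finset.sum_le_sum fun c _ => hterm c) (inv_nonneg.2 (Nat.cast_nonneg _))

/-- `((k−1)/k)^d → 1`. [folklore] -/
private theorem tendsto_sub_one_div_pow : Tendsto (fun k : ℕ => (((k : ℝ) - 1) / k) ^ d) atTop (𝓝 1) := by
  have h1 : Tendsto (fun k : ℕ => ((k : ℝ) - 1) / k) atTop (𝓝 1) := by
    have : Tendsto (fun k : ℕ => 1 - (1 : ℝ) / k) atTop (𝓝 (1 - 0)) :=
      tendsto_const_nhds.sub (tendsto_const_div_atTop_nhds_zero_nat _)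
    rw [sub_zero] at this
    refine this.congr' ?_
    filter_upwards [Filter.eventually_ge_atTop 1] with k hk
    have hk0 : (k : ℝ) ≠ 0 := by exact_mod_cast (by omega : k ≠ 0)
    field_simp
  have h2 := h1.pow d
  rwa [one_pow] at h2

include hn in
/-- **THE ENTROPY DENSITY OF THE TRIAL STATE**: `S(ρ₀)/n^d ≤ s̄(ω̄_n)` (`d ≥ 1`). [cite: BratteliRobinsonII1997, Thm. 6.2.40]
[cite: ArakiMoriya2003, Theorem 3.8 and §10] -/
theorem le_entropyDensitySup_boxTrialState (hd : 0 < d) :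
    vonNeumannEntropy ρ₀ / (n : ℝ) ^ d ≤ (boxTrialState n hn ρ₀ hev hpd.posSemidef htr).entropyDensitySup := by
  have hTI := boxTrialState_isTranslationInvariant n hn ρ₀ hev hpd.posSemidef htr
  have hlim := hTI.tendsto_boxEntropyDensity hd
  -- along the multiples `k n`
  have hmul : Tendsto (fun k : ℕ => k * n) atTop atTop :=
    tendsto_atTop_mono (fun k => Nat.le_mul_of_pos_right k hn) tendsto_id
  have hsub := hlim.comp hmul
  have hn0 : (0 : ℝ) < n := by exact_mod_cast hn
  -- the lower bounds `((k−1)/k)^d · S(ρ₀)/n^d → S(ρ₀)/n^d`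
  have hb : Tendsto (fun k : ℕ => (((k : ℝ) - 1) / k) ^ d * (vonNeumannEntropy ρ₀ / (n : ℝ) ^ d)) atTop
      (𝓝 (vonNeumannEntropy ρ₀ / (n : ℝ) ^ d)) := by
    have h := (tendsto_sub_one_div_pow (d := d)).mul_const (vonNeumannEntropy ρ₀ / (n : ℝ) ^ d)
    rwa [one_mul] at h
  refine le_of_tendsto_of_tendsto hb hsub ?_
  filter_upwards [Filter.eventually_ge_atTop 1] with k hk
  have hk0 : (0 : ℝ) < k := by exact_mod_cast hk
  simp only [Function.comp_apply, boxEntropyDensity_apply]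
  have hkn : (0 : ℝ) < ((k * n : ℕ) : ℝ) ^ d := by positivity
  rw [le_div_iff₀ hkn]
  have h := pow_mul_le_vonNeumannEntropy_rdm_boxTrialState n hn ρ₀ hev hpd htr hk
  have e : (((k : ℝ) - 1) / k) ^ d * (vonNeumannEntropy ρ₀ / (n : ℝ) ^ d) * ((k * n : ℕ) : ℝ) ^ d =
      ((k : ℝ) - 1) ^ d * vonNeumannEntropy ρ₀ := by
    push_cast
    rw [div_pow, mul_pow]
    field_simp
  rw [e]
  exact h

end Entropy

/-! ### §3. The energy density of the trial state -/

section Energy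

variable (n : ℕ) (hn : 1 ≤ n) (ρ₀ : FermionOp (halfOpenBox d n)) (hev : parityAut ρ₀ = ρ₀) (hpsd : ρ₀.PosSemidef) (htr : ρ₀.trace = 1)
  {Ψ : FermionInteraction d} {R : ℝ}

/-- **The tiling state on the Hamiltonian of an aligned big box** `[0,kn)^d` (decoupled boxes + straddling terms):
`ω_n(H_{[0,kn)^d}) = k^d tr(H_{[0,n)^d} ρ₀) + ω_n(W) − (k^d − 1)(Ψ∅)_{∅∅}` with `|Re ω_n(W)| ≤ k^d col_R(n) S_Ψ`, packaged as
`|Re ω_n(H_{[0,kn)^d}) − (k^d Re tr(H_{[0,n)^d}ρ₀) − (k^d − 1) Re(Ψ∅)_{∅∅})| ≤ k^d col_R(n) S_Ψ`.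
[cite: BratteliRobinsonII1997, Thm. 6.2.40] [cite: BratteliKishimotoRobinson1978, §3 (H̃_Φ(Λ), W_Φ(Λ), p. 47)] -/
theorem abs_re_expect_localHamiltonian_box_sub_le (hT : Ψ.IsTranslationInvariant) (hR : Ψ.HasFiniteRange R) (k : ℕ) :
    |((boxTilingState n hn ρ₀ hev hpsd htr).expect (halfOpenBox d (k * n)) (Ψ.localHamiltonian (halfOpenBox d (k * n)))).re -
        ((k : ℝ) ^ d * (Ψ.localHamiltonian (halfOpenBox d n) * ρ₀).trace.re - ((k : ℝ) ^ d - 1) * ((Ψ.Φ ∅) ∅ ∅).re)| ≤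
      (k : ℝ) ^ d * ((((thicken (halfOpenBox d n) R \ halfOpenBox d n).card : ℝ)) *
        ∑ X ∈ (thicken ({0} : Finset (Site d)) R).powerset with (0 : Site d) ∈ X, ‖Ψ.Φ X‖) := by
  set ω := boxTilingState n hn ρ₀ hev hpsd htr with hω
  set W := ∑ Y ∈ (halfOpenBox d (k * n)).powerset with
      (Y ≠ ∅ ∧ ∀ j : halfOpenBox d k, ¬ Y ⊆ shiftSet ((n : ℤ) • (j : Site d)) (halfOpenBox d n)),
    (if h : Y ⊆ halfOpenBox d (k * n) then fermionEmbed (PolySite.incl h) (Ψ.Φ Y) else 0) with hW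
  have hdec := Ψ.localHamiltonian_box_eq_decoupled_add_straddling_sub hn k
  rw [← hW] at hdec
  have hcard : (Fintype.card (halfOpenBox d k) : ℂ) = ((k : ℝ) ^ d : ℝ) := by
    rw [Fintype.card_coe, card_halfOpenBox]; push_cast; rfl
  -- the decoupled part
  have hbox : ∀ j : halfOpenBox d k, ω.expect (halfOpenBox d (k * n))
      (fermionEmbed (PolySite.incl (shiftSet_smul_halfOpenBox_subset (le_refl (k * n)) j.2))
        (Ψ.localHamiltonian (shiftSet ((n : ℤ) • (j : Site d)) (halfOpenBox d n)))) =
      (Ψ.localHamiltonian (halfOpenBox d n) * ρ₀).trace := fun j => by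
    rw [ω.compatible, hω, boxTilingState_expect_localHamiltonian n hn ρ₀ hev hpsd htr hT]
  have hval : ω.expect (halfOpenBox d (k * n)) (Ψ.localHamiltonian (halfOpenBox d (k * n))) =
      (((k : ℝ) ^ d : ℝ) : ℂ) * (Ψ.localHamiltonian (halfOpenBox d n) * ρ₀).trace + ω.expect _ W -
        ((((k : ℝ) ^ d : ℝ) : ℂ) - 1) * ((Ψ.Φ ∅) ∅ ∅) := by
    rw [hdec, map_sub, map_add, map_sum, map_smul, ω.expect_one, smul_eq_mul, mul_one, hcard]
    simp only [hbox, Finset.sum_const, Finset.card_univ, nsmul_eq_mul, hcard]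
  have hWn : |(ω.expect _ W).re| ≤ (k : ℝ) ^ d * ((((thicken (halfOpenBox d n) R \ halfOpenBox d n).card : ℝ)) *
      ∑ X ∈ (thicken ({0} : Finset (Site d)) R).powerset with (0 : Site d) ∈ X, ‖Ψ.Φ X‖) := by
    refine (ω.abs_re_expect_le _ W).trans ?_
    have h := FermionInteraction.norm_straddling_le hT hR hn k
    rw [← hW, Fintype.card_coe, card_halfOpenBox] at h
    push_cast at h
    exact h
  rw [hval]
  simp only [Complex.sub_re, Complex.sub_im, Complex.add_re, Complex.mul_re, Complex.ofReal_re, Complex.ofReal_im,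
    Complex.one_re, Complex.one_im, sub_self, zero_mul, sub_zero]
  have e : (k : ℝ) ^ d * (Ψ.localHamiltonian (halfOpenBox d n) * ρ₀).trace.re + (ω.expect _ W).re -
      ((k : ℝ) ^ d - 1) * ((Ψ.Φ ∅) ∅ ∅).re -
      ((k : ℝ) ^ d * (Ψ.localHamiltonian (halfOpenBox d n) * ρ₀).trace.re - ((k : ℝ) ^ d - 1) * ((Ψ.Φ ∅) ∅ ∅).re) =
      (ω.expect _ W).re := by ring
  rw [e]
  exact hWn

/-- The aligned inner box `n·1⃗ + [0,(k−2)n)^d` lies in every translate `[0,kn)^d + v`, `v ∈ [0,n)^d` (`k ≥ 2`).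
[cite: BratteliRobinsonII1997, Thm. 6.2.40] -/
theorem shiftSet_smul_one_subset_shiftSet {k : ℕ} (hk : 2 ≤ k) {v : Site d} (hv : v ∈ halfOpenBox d n) :
    shiftSet ((n : ℤ) • fun _ : Fin d => (1 : ℤ)) (halfOpenBox d ((k - 2) * n)) ⊆ shiftSet v (halfOpenBox d (k * n)) := by
  intro x hx
  rw [mem_shiftSet, mem_halfOpenBox] at hx ⊢
  rw [mem_halfOpenBox] at hv
  intro i
  obtain ⟨h1, h2⟩ := hx i
  obtain ⟨hv1, hv2⟩ := hv i
  simp only [Pi.sub_apply, Pi.smul_apply, smul_eq_mul, mul_one] at h1 h2 ⊢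
  have hk' : (((k - 2) * n : ℕ) : ℤ) = ((k : ℤ) - 2) * n := by
    rw [Nat.cast_mul, Nat.cast_sub hk]; push_cast; ring
  rw [hk'] at h2
  have hn0 : (0 : ℤ) ≤ n := Int.natCast_nonneg n
  push_cast
  constructor
  · linarith
  · nlinarith

/-- **Translates versus the aligned inner box**: for `v ∈ [0,n)^d` and `k ≥ 2`,
`|Re ω_n(H_{[0,kn)^d + v}) − Re ω_n(H_{[0,(k−2)n)^d})| ≤ ((kn)^d − ((k−2)n)^d) S_Ψ` (periodicity moves the inner box to the origin;
the remaining terms are carried by the `(kn)^d − ((k−2)n)^d` outer sites). [cite: BratteliRobinsonII1997, Thm. 6.2.40]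
[cite: BratteliKishimotoRobinson1978, §3 (H̃_Φ(Λ), W_Φ(Λ), p. 47)] -/
theorem abs_re_expect_localHamiltonian_shiftSet_sub_le (hT : Ψ.IsTranslationInvariant) (hR : Ψ.HasFiniteRange R) {k : ℕ} (hk : 2 ≤ k)
    {v : Site d} (hv : v ∈ halfOpenBox d n) :
    |((boxTilingState n hn ρ₀ hev hpsd htr).expect (shiftSet v (halfOpenBox d (k * n)))
          (Ψ.localHamiltonian (shiftSet v (halfOpenBox d (k * n))))).re -
        ((boxTilingState n hn ρ₀ hev hpsd htr).expect (halfOpenBox d ((k - 2) * n))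
          (Ψ.localHamiltonian (halfOpenBox d ((k - 2) * n)))).re| ≤
      (((k * n) ^ d - ((k - 2) * n) ^ d : ℕ) : ℝ) *
        ∑ X ∈ (thicken ({0} : Finset (Site d)) R).powerset with (0 : Site d) ∈ X, ‖Ψ.Φ X‖ := by
  set ω := boxTilingState n hn ρ₀ hev hpsd htr with hω
  set u : Site d := (n : ℤ) • fun _ : Fin d => (1 : ℤ) with hu
  have hsub := shiftSet_smul_one_subset_shiftSet n hk hv
  rw [← hu] at hsub
  -- periodicity: the inner box at `u = n·1⃗` has the expectation of the box at the origin
  have hper : ω.expect (shiftSet u (halfOpenBox d ((k - 2) * n))) (Ψ.localHamiltonian (shiftSet u (halfOpenBox d ((k - 2) * n)))) =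
      ω.expect (halfOpenBox d ((k - 2) * n)) (Ψ.localHamiltonian (halfOpenBox d ((k - 2) * n))) := by
    have h := boxTilingState_shift_smul n hn ρ₀ hev hpsd htr (fun _ : Fin d => (1 : ℤ))
    rw [← hω, ← hu] at h
    conv_rhs => rw [← h, shift_expect, hT.fermionEmbed_shiftEmb_localHamiltonian]
  -- decomposition along the inner box
  have hdec := Ψ.localHamiltonian_eq_fermionEmbed_add_far_add_cross hsub
  rw [hdec, add_assoc, map_add, ω.compatible hsub, hper, Complex.add_re, add_sub_cancel_left]
  refine (ω.abs_re_expect_le _ _).trans ((FermionInteraction.norm_far_add_cross_le hT hR _ _).trans (le_of_eq ?_))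
  congr 1
  rw [Finset.card_sdiff_of_subset hsub, card_shiftSet_halfOpenBox, card_shiftSet_halfOpenBox]

/-- Averaging an estimate: if `|f k − A| ≤ B` for every `k`, then `||κ|⁻¹ Σ_k f k − A| ≤ B`. [folklore] -/
private theorem abs_inv_card_mul_sum_sub_le {κ : Type} [Fintype κ] [Nonempty κ] (f : κ → ℝ) (A B : ℝ)
    (h : ∀ k, |f k - A| ≤ B) : |(Fintype.card κ : ℝ)⁻¹ * ∑ k, f k - A| ≤ B := by
  have hN : (0 : ℝ) < Fintype.card κ := by exact_mod_cast Fintype.card_pos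
  have hsum : (Fintype.card κ : ℝ)⁻¹ * ∑ k, f k - A = (Fintype.card κ : ℝ)⁻¹ * ∑ k, (f k - A) := by
    rw [Finset.sum_sub_distrib, Finset.sum_const, Finset.card_univ, nsmul_eq_mul, mul_sub, ← mul_assoc,
      inv_mul_cancel₀ hN.ne', one_mul]
  rw [hsum, abs_mul, abs_of_pos (inv_pos.2 hN)]
  calc (Fintype.card κ : ℝ)⁻¹ * |∑ k, (f k - A)| ≤ (Fintype.card κ : ℝ)⁻¹ * ∑ k, |f k - A| :=
        mul_le_mul_of_nonneg_left (Finset.abs_sum_le_sum_abs _ _) (inv_nonneg.2 hN.le)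
    _ ≤ (Fintype.card κ : ℝ)⁻¹ * ∑ _k : κ, B := mul_le_mul_of_nonneg_left (Finset.sum_le_sum fun k _ => h k) (inv_nonneg.2 hN.le)
    _ = B := by rw [Finset.sum_const, Finset.card_univ, nsmul_eq_mul, ← mul_assoc, inv_mul_cancel₀ hN.ne', one_mul]

include hn in
/-- **The trial state on the big-box Hamiltonian** (average over the cell of the translate estimates): for `k ≥ 2`,
`|Re ω̄_n(H_{[0,kn)^d}) − ((k−2)^d Re tr(H_{[0,n)^d}ρ₀) − ((k−2)^d − 1) Re(Ψ∅)_{∅∅})| ≤ ((kn)^d − ((k−2)n)^d) S_Ψ + (k−2)^d col_R(n) S_Ψ`.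
[cite: BratteliRobinsonII1997, Thm. 6.2.40] -/
theorem abs_re_expect_boxTrialState_localHamiltonian_sub_le (hT : Ψ.IsTranslationInvariant) (hR : Ψ.HasFiniteRange R) {k : ℕ} (hk : 2 ≤ k) :
    |((boxTrialState n hn ρ₀ hev hpsd htr).expect (halfOpenBox d (k * n)) (Ψ.localHamiltonian (halfOpenBox d (k * n)))).re -
        (((k : ℝ) - 2) ^ d * (Ψ.localHamiltonian (halfOpenBox d n) * ρ₀).trace.re - (((k : ℝ) - 2) ^ d - 1) * ((Ψ.Φ ∅) ∅ ∅).re)| ≤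
      (((k : ℝ) * n) ^ d - (((k : ℝ) - 2) * n) ^ d) * (∑ X ∈ (thicken ({0} : Finset (Site d)) R).powerset with (0 : Site d) ∈ X, ‖Ψ.Φ X‖) +
        ((k : ℝ) - 2) ^ d * ((((thicken (halfOpenBox d n) R \ halfOpenBox d n).card : ℝ)) *
          ∑ X ∈ (thicken ({0} : Finset (Site d)) R).powerset with (0 : Site d) ∈ X, ‖Ψ.Φ X‖) := by
  -- `Re ν(H) = |C|⁻¹ Σ_c Re ω(H_{[0,kn)^d + pos c})`
  have h2 : ((boxTrialState n hn ρ₀ hev hpsd htr).expect (halfOpenBox d (k * n)) (Ψ.localHamiltonian (halfOpenBox d (k * n)))).re =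
      (Fintype.card (Cell (fun _ : Fin d => n - 1)) : ℝ)⁻¹ *
        ∑ cc : Cell (fun _ : Fin d => n - 1), ((boxTilingState n hn ρ₀ hev hpsd htr).expect (shiftSet (cellPos cc) (halfOpenBox d (k * n)))
          (Ψ.localHamiltonian (shiftSet (cellPos cc) (halfOpenBox d (k * n))))).re := by
    have hs : ∀ cc : Cell (fun _ : Fin d => n - 1),
        fermionEmbed (PolySite.shiftEmb (cellPos cc) (halfOpenBox d (k * n))) (Ψ.localHamiltonian (halfOpenBox d (k * n))) =
          Ψ.localHamiltonian (shiftSet (cellPos cc) (halfOpenBox d (k * n))) := fun cc => hT.fermionEmbed_shiftEmb_localHamiltonian _ _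
    simp only [boxTrialState_expect, Complex.re_ofReal_mul, Complex.re_sum, hs]
  have hk2' : ((k - 2 : ℕ) : ℝ) = (k : ℝ) - 2 := by
    rw [Nat.cast_sub hk, Nat.cast_ofNat]
  have hcast : ((((k * n) ^ d - ((k - 2) * n) ^ d : ℕ)) : ℝ) = ((k : ℝ) * n) ^ d - (((k : ℝ) - 2) * n) ^ d := by
    rw [Nat.cast_sub (Nat.pow_le_pow_left (Nat.mul_le_mul_right n (Nat.sub_le k 2)) d)]
    push_cast
    rw [hk2']
  -- per translate: inner box + periodicity + decoupling
  have key := abs_inv_card_mul_sum_sub_le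
    (fun cc : Cell (fun _ : Fin d => n - 1) => ((boxTilingState n hn ρ₀ hev hpsd htr).expect (shiftSet (cellPos cc) (halfOpenBox d (k * n)))
      (Ψ.localHamiltonian (shiftSet (cellPos cc) (halfOpenBox d (k * n))))).re)
    (((k : ℝ) - 2) ^ d * (Ψ.localHamiltonian (halfOpenBox d n) * ρ₀).trace.re - (((k : ℝ) - 2) ^ d - 1) * ((Ψ.Φ ∅) ∅ ∅).re)
    ((((k : ℝ) * n) ^ d - (((k : ℝ) - 2) * n) ^ d) * (∑ X ∈ (thicken ({0} : Finset (Site d)) R).powerset with (0 : Site d) ∈ X, ‖Ψ.Φ X‖) +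
        ((k : ℝ) - 2) ^ d * ((((thicken (halfOpenBox d n) R \ halfOpenBox d n).card : ℝ)) *
          ∑ X ∈ (thicken ({0} : Finset (Site d)) R).powerset with (0 : Site d) ∈ X, ‖Ψ.Φ X‖))
    (fun cc => by
      have ha := abs_re_expect_localHamiltonian_shiftSet_sub_le n hn ρ₀ hev hpsd htr hT hR hk (cellPos_mem_halfOpenBox n hn cc)
      have hb := abs_re_expect_localHamiltonian_box_sub_le n hn ρ₀ hev hpsd htr hT hR (k - 2)
      rw [hk2'] at hb
      rw [hcast] at ha
      exact (abs_sub_le _ _ _).trans (add_le_add ha hb))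
  calc _ = _ := congrArg (fun x : ℝ => |x - (((k : ℝ) - 2) ^ d * (Ψ.localHamiltonian (halfOpenBox d n) * ρ₀).trace.re -
      (((k : ℝ) - 2) ^ d - 1) * ((Ψ.Φ ∅) ∅ ∅).re)|) h2
    _ ≤ _ := key

include hn in
/-- **Finite-volume energy estimate for the trial state**: for `k ≥ 2`,
`|(kn)^d e_Ψ(ω̄_n) − (k−2)^d (Re tr(H_{[0,n)^d}ρ₀) − Re(Ψ∅)_{∅∅})| ≤ col_R(kn) S_Ψ + ((kn)^d − ((k−2)n)^d) S_Ψ + (k−2)^d col_R(n) S_Ψ`.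
[cite: BratteliRobinsonII1997, Thm. 6.2.40] [cite: BratteliKishimotoRobinson1978, §3 (H_Φ(ω) = lim ω(H_Φ(Λ))/|Λ|, p. 47)] -/
theorem abs_pow_mul_meanEnergy_boxTrialState_sub_le (hT : Ψ.IsTranslationInvariant) (hR : Ψ.HasFiniteRange R) {k : ℕ} (hk : 2 ≤ k) :
    |((k : ℝ) * n) ^ d * (boxTrialState n hn ρ₀ hev hpsd htr).meanEnergy Ψ R -
        ((k : ℝ) - 2) ^ d * ((Ψ.localHamiltonian (halfOpenBox d n) * ρ₀).trace.re - ((Ψ.Φ ∅) ∅ ∅).re)| ≤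
      (((thicken (halfOpenBox d (k * n)) R \ halfOpenBox d (k * n)).card : ℝ)) *
          (∑ X ∈ (thicken ({0} : Finset (Site d)) R).powerset with (0 : Site d) ∈ X, ‖Ψ.Φ X‖) +
        (((k : ℝ) * n) ^ d - (((k : ℝ) - 2) * n) ^ d) * (∑ X ∈ (thicken ({0} : Finset (Site d)) R).powerset with (0 : Site d) ∈ X, ‖Ψ.Φ X‖) +
        ((k : ℝ) - 2) ^ d * ((((thicken (halfOpenBox d n) R \ halfOpenBox d n).card : ℝ)) *
          ∑ X ∈ (thicken ({0} : Finset (Site d)) R).powerset with (0 : Site d) ∈ X, ‖Ψ.Φ X‖) := by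
  have hTI := boxTrialState_isTranslationInvariant n hn ρ₀ hev hpsd htr
  have h1 := hTI.abs_card_mul_meanEnergy_sub_le hT hR (halfOpenBox d (k * n))
  rw [card_halfOpenBox, expect_empty_eq] at h1
  push_cast at h1
  have hB := abs_re_expect_boxTrialState_localHamiltonian_sub_le n hn ρ₀ hev hpsd htr hT hR hk
  set ν := boxTrialState n hn ρ₀ hev hpsd htr
  have e1 : ((k : ℝ) * n) ^ d * ν.meanEnergy Ψ R -
      ((k : ℝ) - 2) ^ d * ((Ψ.localHamiltonian (halfOpenBox d n) * ρ₀).trace.re - ((Ψ.Φ ∅) ∅ ∅).re) =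
      (((k : ℝ) * n) ^ d * ν.meanEnergy Ψ R -
          ((ν.expect (halfOpenBox d (k * n)) (Ψ.localHamiltonian (halfOpenBox d (k * n)))).re - ((Ψ.Φ ∅) ∅ ∅).re)) +
        ((ν.expect (halfOpenBox d (k * n)) (Ψ.localHamiltonian (halfOpenBox d (k * n)))).re -
          (((k : ℝ) - 2) ^ d * (Ψ.localHamiltonian (halfOpenBox d n) * ρ₀).trace.re - (((k : ℝ) - 2) ^ d - 1) * ((Ψ.Φ ∅) ∅ ∅).re)) := by
    ring
  calc _ = _ := congrArg (fun x : ℝ => |x|) e1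
    _ ≤ _ := abs_add_le _ _
    _ ≤ _ := add_le_add h1 hB
    _ = _ := (add_assoc _ _ _).symm

/-- `((k−2)/k)^d → 1`. [folklore] -/
private theorem tendsto_sub_two_div_pow : Tendsto (fun k : ℕ => (((k : ℝ) - 2) / k) ^ d) atTop (𝓝 1) := by
  have h1 : Tendsto (fun k : ℕ => ((k : ℝ) - 2) / k) atTop (𝓝 1) := by
    have : Tendsto (fun k : ℕ => 1 - (2 : ℝ) / k) atTop (𝓝 (1 - 0)) :=
      tendsto_const_nhds.sub (tendsto_const_div_atTop_nhds_zero_nat _)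
    rw [sub_zero] at this
    refine this.congr' ?_
    filter_upwards [Filter.eventually_ge_atTop 1] with k hk
    have hk0 : (k : ℝ) ≠ 0 := by exact_mod_cast (by omega : k ≠ 0)
    field_simp
  have h2 := h1.pow d
  rwa [one_pow] at h2

include hn in
/-- **THE ENERGY DENSITY OF THE TRIAL STATE**: for a translation-covariant interaction `Ψ` of finite range `R` (`d ≥ 1`),
`|e_Ψ(ω̄_n) − (Re tr(H_{[0,n)^d} ρ₀) − Re(Ψ∅)_{∅∅})/n^d| ≤ col_R(n)·S_Ψ/n^d`, `col_R(n) = |thicken_R([0,n)^d) ∖ [0,n)^d|`.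
[cite: BratteliRobinsonII1997, Thm. 6.2.40] [cite: BratteliKishimotoRobinson1978, §3 (H_Φ(ω) = lim ω(H_Φ(Λ))/|Λ|, p. 47)] -/
theorem abs_meanEnergy_boxTrialState_sub_le (hd : 0 < d) (hT : Ψ.IsTranslationInvariant) (hR : Ψ.HasFiniteRange R) :
    |(boxTrialState n hn ρ₀ hev hpsd htr).meanEnergy Ψ R -
        ((Ψ.localHamiltonian (halfOpenBox d n) * ρ₀).trace.re - ((Ψ.Φ ∅) ∅ ∅).re) / (n : ℝ) ^ d| ≤
      (((thicken (halfOpenBox d n) R \ halfOpenBox d n).card : ℝ) *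
          ∑ X ∈ (thicken ({0} : Finset (Site d)) R).powerset with (0 : Site d) ∈ X, ‖Ψ.Φ X‖) / (n : ℝ) ^ d := by
  set S : ℝ := ∑ X ∈ (thicken ({0} : Finset (Site d)) R).powerset with (0 : Site d) ∈ X, ‖Ψ.Φ X‖ with hS
  set col : ℕ → ℝ := fun m => (((thicken (halfOpenBox d m) R \ halfOpenBox d m).card : ℝ)) with hcol
  set D : ℝ := (Ψ.localHamiltonian (halfOpenBox d n) * ρ₀).trace.re - ((Ψ.Φ ∅) ∅ ∅).re with hD
  set e : ℝ := (boxTrialState n hn ρ₀ hev hpsd htr).meanEnergy Ψ R with he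
  have hn0 : (0 : ℝ) < n := by exact_mod_cast hn
  have hmain : ∀ k : ℕ, 2 ≤ k → |((k : ℝ) * n) ^ d * e - ((k : ℝ) - 2) ^ d * D| ≤
      col (k * n) * S + (((k : ℝ) * n) ^ d - (((k : ℝ) - 2) * n) ^ d) * S + ((k : ℝ) - 2) ^ d * (col n * S) := fun k hk =>
    abs_pow_mul_meanEnergy_boxTrialState_sub_le n hn ρ₀ hev hpsd htr hT hR hk
  -- LIMIT `k → ∞` after division by `(kn)^d`
  have hf := tendsto_sub_two_div_pow (d := d)
  have hmul : Tendsto (fun k : ℕ => k * n) atTop atTop := tendsto_atTop_mono (fun k => Nat.le_mul_of_pos_right k hn) tendsto_id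
  have hcolk : Tendsto (fun k : ℕ => col (k * n) / (((k : ℝ) * n) ^ d)) atTop (𝓝 0) := by
    have h := (FermionInteraction.tendsto_collar_div_pow hd R).comp hmul
    refine h.congr fun k => ?_
    simp only [Function.comp_apply, hcol]
    push_cast
    rfl
  have hL : Tendsto (fun k : ℕ => |e - (((k : ℝ) - 2) / k) ^ d * (D / (n : ℝ) ^ d)|) atTop (𝓝 |e - D / (n : ℝ) ^ d|) := by
    have h := (tendsto_const_nhds (x := e)).sub (hf.mul_const (D / (n : ℝ) ^ d))
    rw [one_mul] at h
    exact h.abs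
  have hRt : Tendsto (fun k : ℕ => col (k * n) / (((k : ℝ) * n) ^ d) * S + (1 - (((k : ℝ) - 2) / k) ^ d) * S +
      (((k : ℝ) - 2) / k) ^ d * (col n * S / (n : ℝ) ^ d)) atTop (𝓝 (col n * S / (n : ℝ) ^ d)) := by
    have h := ((hcolk.mul_const S).add (((tendsto_const_nhds (x := (1 : ℝ))).sub hf).mul_const S)).add
      (hf.mul_const (col n * S / (n : ℝ) ^ d))
    rw [zero_mul, sub_self, zero_mul, zero_add, zero_add, one_mul] at h
    exact h
  refine le_of_tendsto_of_tendsto hL hRt ?_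
  filter_upwards [Filter.eventually_ge_atTop 2] with k hk
  have hk0 : (0 : ℝ) < k := by exact_mod_cast (by omega : 0 < k)
  have hN : (0 : ℝ) < ((k : ℝ) * n) ^ d := by positivity
  have hdiv := div_le_div_of_nonneg_right (hmain k hk) hN.le
  rw [← abs_of_pos hN, ← abs_div, abs_of_pos hN] at hdiv
  have eL : (((k : ℝ) * n) ^ d * e - ((k : ℝ) - 2) ^ d * D) / ((k : ℝ) * n) ^ d =
      e - (((k : ℝ) - 2) / k) ^ d * (D / (n : ℝ) ^ d) := by
    rw [mul_pow, div_pow]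
    field_simp
  have eR : (col (k * n) * S + (((k : ℝ) * n) ^ d - (((k : ℝ) - 2) * n) ^ d) * S + ((k : ℝ) - 2) ^ d * (col n * S)) / ((k : ℝ) * n) ^ d =
      col (k * n) / (((k : ℝ) * n) ^ d) * S + (1 - (((k : ℝ) - 2) / k) ^ d) * S + (((k : ℝ) - 2) / k) ^ d * (col n * S / (n : ℝ) ^ d) := by
    rw [mul_pow, mul_pow, div_pow]
    field_simp
  rw [eL, eR] at hdiv
  exact hdiv

end Energy

end InfVolFermionState

end Literature.MathematicalPhysics.QuantumLattice

end
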